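import Literature.AnabelianGeometry.SemiGraphs.TemperedPiTowerNonabelianLevel
import Literature.AnabelianGeometry.SemiGraphs.WitnessIwahoriBundle
import Literature.AnabelianGeometry.SemiGraphs.BouquetCriteria
import HarnessLib

/-!
# The virtually free tower of `π₁^temp(𝒢)` for finite GRAPHS, and non-vacuity inside the class of
# Prop. 3.6 ([SemiAnbd] Prop. 3.6 p. 38; the witness `𝒢₁` of Def. 2.1 p. 22)

Mochizuki, *Semi-graphs of anabelioids*, Publ. RIMS **42** (2006) [SemiAnbd], Prop. 3.6 p. 38
("`π₁^temp(𝒢) := lim Gal(𝒢_{∞,i}/𝒢)`"). [cite: MochizukiSemiAnbd2006, Prop 3.6 p.38]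

PROOF-ONLY file (abc-iut cell, prover abc-iut-w5-d240; no definitions), sequel of
`TemperedPiTowerNonabelianLevel.lean`:
* `temperedPi_tower_of_isGraph`, `TemperedPiChart.tower_of_isGraph` — the tower property `htower₀` of
  `π₁^temp(𝒢)` (at the model and for every chart) for `𝒢` satisfying the hypotheses of Prop. 3.6 whose
  underlying semi-graph is a FINITE GRAPH (every branch abuts) with at least one edge — the form in
  which dual graphs of pointed stable curves with a node occur;
* NON-VACUITY inside the class of Prop. 3.6: the Iwahori witness `𝒢₁ = IwahoriWitness.loopGraph p`
  (`WitnessIwahoriLoop.lean`, a `Prop36Hypotheses` object on the bouquet `H_1`) satisfies every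
  hypothesis, so `htower₀` HOLDS for `π₁^temp(𝒢₁)` (`IwahoriWitness.loopGraph_temperedPi_tower`) and the
  hypothesis set of `temperedPi_tower_of_isClosedEdge` is inhabited
  (`exists_prop36Hypotheses_temperedPi_tower`) — the open non-vacuity item recorded with
  `TemperedPiTowerOfGaloisSeq.lean` ("NV inside the Prop 3.6 class"), now a consequence of the theorem.

Nothing here bears on [IUTchIII] Cor. 3.12 or takes a side on any disputed claim.
-/

noncomputable section

namespace Literature.AnabelianGeometry.SemiGraphs

namespace ProfiniteSemiGraph

open CategoryTheory

universe u

variable (𝒢 : ProfiniteSemiGraph.{u}) (h36 : 𝒢.Prop36Hypotheses)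

/-- **`htower₀` at the model for finite graphs with an edge**: if the underlying semi-graph of `𝒢`
(hypotheses of Prop. 3.6) is a finite graph — every branch abuts — with at least one edge, the tempered
fundamental group `𝒢.temperedPi h36` has the virtually free tower property (every edge of a graph is
closed). [cite: MochizukiSemiAnbd2006, Prop 3.6(i) p.38] -/
theorem temperedPi_tower_of_isGraph [Finite 𝒢.graph.Vertex] [Finite 𝒢.graph.Edge]
    (hG : 𝒢.graph.IsGraph) [Nonempty 𝒢.graph.Edge] :
    ∀ U ∈ nhds (1 : 𝒢.temperedPi h36), ∃ N : OpenNormalSubgroup (𝒢.temperedPi h36),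
      (N : Set (𝒢.temperedPi h36)) ⊆ U ∧
      ∃ (G : Subgroup (𝒢.temperedPi h36 ⧸ N.toSubgroup)) (_ : IsFreeGroup G), G.Normal ∧
        G.FiniteIndex ∧ Finite (IsFreeGroup.Generators G) ∧ ∃ a ∈ G, ∃ b ∈ G, a * b ≠ b * a :=
  𝒢.temperedPi_tower_of_isClosedEdge h36
    ⟨Classical.arbitrary 𝒢.graph.Edge, hG.vertCard_eq_two _⟩

/-- **`htower₀` for every chart, for finite graphs with an edge.**
[cite: MochizukiSemiAnbd2006, Prop 3.6 p.38] -/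
theorem TemperedPiChart.tower_of_isGraph {𝒢 : ProfiniteSemiGraph.{u}} (c : TemperedPiChart 𝒢)
    (h36 : 𝒢.Prop36Hypotheses) [Finite 𝒢.graph.Vertex]
    [Finite 𝒢.graph.Edge] (hG : 𝒢.graph.IsGraph) [Nonempty 𝒢.graph.Edge] :
    ∀ U ∈ nhds (1 : c.G), ∃ N : OpenNormalSubgroup c.G, (N : Set c.G) ⊆ U ∧
      ∃ (G : Subgroup (c.G ⧸ N.toSubgroup)) (_ : IsFreeGroup G), G.Normal ∧ G.FiniteIndex ∧
        Finite (IsFreeGroup.Generators G) ∧ ∃ a ∈ G, ∃ b ∈ G, a * b ≠ b * a :=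
  c.tower_of_isClosedEdge h36 ⟨Classical.arbitrary 𝒢.graph.Edge, hG.vertCard_eq_two _⟩

end ProfiniteSemiGraph

/-! ### Non-vacuity inside the class of Prop. 3.6: the Iwahori witness `𝒢₁` -/

namespace IwahoriWitness

open ProfiniteSemiGraph

variable (p : ℕ) [Fact p.Prime]

/-- **`htower₀` HOLDS for `π₁^temp(𝒢₁)`**, the Iwahori witness of the class of Prop. 3.6 (bouquet `H_1`,
vertex group `ℤ_p ⋊ (1 + pℤ_p)`): an instance of `temperedPi_tower_of_isGraph`.
[cite: MochizukiSemiAnbd2006, Prop 3.6(i) p.38] -/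
theorem loopGraph_temperedPi_tower :
    ∀ U ∈ nhds (1 : (loopGraph p).temperedPi (loopGraph_prop36Hypotheses p)),
      ∃ N : OpenNormalSubgroup ((loopGraph p).temperedPi (loopGraph_prop36Hypotheses p)),
      (N : Set ((loopGraph p).temperedPi (loopGraph_prop36Hypotheses p))) ⊆ U ∧
      ∃ (G : Subgroup ((loopGraph p).temperedPi (loopGraph_prop36Hypotheses p) ⧸ N.toSubgroup))
        (_ : IsFreeGroup G), G.Normal ∧ G.FiniteIndex ∧ Finite (IsFreeGroup.Generators G) ∧
        ∃ a ∈ G, ∃ b ∈ G, a * b ≠ b * a := by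
  haveI : Finite (loopGraph p).graph.Vertex := inferInstanceAs (Finite PUnit)
  haveI : Finite (loopGraph p).graph.Edge := inferInstanceAs (Finite (ULift (Fin 1)))
  haveI : Nonempty (loopGraph p).graph.Edge := ⟨⟨0⟩⟩
  exact (loopGraph p).temperedPi_tower_of_isGraph (loopGraph_prop36Hypotheses p) (loopGraph_isGraph p)

/-- **Non-vacuity of the hypothesis set of `temperedPi_tower_of_isClosedEdge` inside the class of
Prop. 3.6**: some `𝒢` satisfying `Prop36Hypotheses` with finite underlying semi-graph and a closed edge
exists (the Iwahori witness), and its `π₁^temp` has the tower property.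
[cite: MochizukiSemiAnbd2006, Prop 3.6(i) p.38] -/
theorem exists_prop36Hypotheses_temperedPi_tower :
    ∃ (𝒢 : ProfiniteSemiGraph.{0}) (h36 : 𝒢.Prop36Hypotheses) (_ : Finite 𝒢.graph.Vertex)
      (_ : Finite 𝒢.graph.Edge), (∃ e : 𝒢.graph.Edge, 𝒢.graph.IsClosedEdge e) ∧
      ∀ U ∈ nhds (1 : 𝒢.temperedPi h36), ∃ N : OpenNormalSubgroup (𝒢.temperedPi h36),
        (N : Set (𝒢.temperedPi h36)) ⊆ U ∧
        ∃ (G : Subgroup (𝒢.temperedPi h36 ⧸ N.toSubgroup)) (_ : IsFreeGroup G), G.Normal ∧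
          G.FiniteIndex ∧ Finite (IsFreeGroup.Generators G) ∧ ∃ a ∈ G, ∃ b ∈ G, a * b ≠ b * a :=
  ⟨loopGraph 2, loopGraph_prop36Hypotheses 2, inferInstanceAs (Finite PUnit),
    inferInstanceAs (Finite (ULift (Fin 1))), ⟨⟨0⟩, (loopGraph_isGraph 2).vertCard_eq_two _⟩,
    loopGraph_temperedPi_tower 2⟩

end IwahoriWitness

end Literature.AnabelianGeometry.SemiGraphs

end
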